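import Literature.NumberTheory.PAdicHodge.AinfWeierstrassEtaPeriod
import Literature.NumberTheory.PAdicHodge.AinfWeierstrassDivisionSaturation
import Literature.NumberTheory.PAdicHodge.WittFrobeniusCongruence
import HarnessLib

/-!
# Frobenius of Fontaine's canonical lift of a `[p]_W`-division tower: `θ(φ[ũ]) = v₀` where `v` is the UNIQUE exact `[p]_W`-tower with
# `‖vₙ − uₙᵖ‖ ≤ ‖p‖` (the «Frobenius-twisted tower» `vₙ = θ(φ[ũ⁽ⁿ⁾])`)

Topic `Literature/NumberTheory/PAdicHodge`; namespace `Literature.NumberTheory.PAdicHodge.AinfTop`. THEOREMS ONLY (no definition, no named fact, no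
instance, no `sorry`). Setting: `F` a `p`-adic field, `𝔸_inf = AinfTop F p` with its `(p, ξ)`-adic topology, Fontaine's `θ : 𝔸_inf → 𝒪_{ℂ_F}`, the Witt
Frobenius `φ` (read on `AinfTop` as `a ↦ of (φ (of⁻¹ a))`), `W/ℤ` an integral Weierstrass equation, `[p] = [p]_W` on `Ŵ(𝔫)` (`mulP`) and on
`Ŵ(𝔪_{ℂ_F})` (`mulPC`), and for an exact `[p]_W`-division tower `u` of `Ŵ(𝔪_{ℂ_F})` its canonical lifts `[ũ⁽ⁿ⁾] = torsionLiftShift W hθ u n` of the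
shifted towers (`[p][ũ⁽ⁿ⁺¹⁾] = [ũ⁽ⁿ⁾]`, `θ[ũ⁽ⁿ⁾] = uₙ`, tree `AinfWeierstrassEtaPeriod`).

* §1 `φ` ON `AinfTop`: `ideal_map_frob_le` (`φ(p, ξ) ⊆ (p, ξ)`: `φξ = ξᵖ + p·h`), `continuous_frob`, `frob_aeval` / `frob_evalPt` (**`φ(f(x)) = f(φx)`** for
  `f ∈ ℤ⟦X⟧`, Mathlib `MvPowerSeries.comp_aeval`), `exists_theta_frob_eq` (**`θ(φa) = θ(a)ᵖ + p·θ(h)`**, from `φa = aᵖ + p·h`),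
  `norm_theta_frob_sub_pow_le` (`‖θ(φa) − θ(a)ᵖ‖ ≤ ‖p‖`), `frob_mem_nilTheta` (`φ𝔫 ⊆ 𝔫`), `frob_mulP` (**`φ ∘ [p] = [p] ∘ φ`** on `Ŵ(𝔫)`).
* §2 ★★ `exists_frobTwist_divisionSeq` — for an exact tower `u`: the sequence `vₙ := θ(φ[ũ⁽ⁿ⁾])` is an EXACT `[p]_W`-division tower of `Ŵ(𝔪_{ℂ_F})` with
  `‖vₙ − uₙᵖ‖ ≤ ‖p‖` and `v₀ = θ(φ[ũ])`; ★★ `theta_frob_torsionLift_eq` — **`θ(φ[ũ]) = v₀` for ANY exact tower `v` with `‖vₙ − uₙᵖ‖ ≤ ‖p‖`** (rigidity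
  of `[p]`-towers, `mulPC_divisionSeq_unique`). So `θ ∘ φ` of the canonical lift is computed by SATURATING the approximate tower `(uₙᵖ)ₙ`.

Purpose (crux K★ `stmt-BirchSwinnertonDyer-22226`, line `kato_lever`, memo `Lines/kato-lever-K2-ramified-cm-transport.md` §9, step T2): the `φ`-partner
`φΛ_N(ι[ũ], z) = Λ_N(ι φ[ũ], φz)` of an `A_max`-period has `θ(f φΛ) = p^N·log_W(θ(φ[ũ])) = p^N·log_W(v₀)`, and by the transport invariance of the
Colmez functional (`SecondKindColmezFunctionalTransport`, `w := v`, sequence `(uₙᵖ)`) `log_W(v₀) = lim pⁿ log_W(uₙᵖ) = 𝒞_u(log_W(Xᵖ))` — the second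
θ-matching of (HL-eval). Infrastructure only; BSD / K★ are not proved by any of this.

## References
* J.-M. Fontaine, *Le corps des périodes p-adiques*, Astérisque 223 (1994), Exp. II §1.1 (`φ` on `𝕎`), §1.2.2, §1.3. [FontaineAsterisque223III]
* P. Colmez, *Périodes p-adiques des variétés abéliennes*, Math. Ann. 292 (1992), §2. [Colmez1992PeriodesAbeliennes]
* N. M. Katz, *Crystalline cohomology, Dieudonné modules, and Jacobi sums* (1981), Thm. 5.1.4 (the Frobenius `X ↦ Xᵖ` on lifts). [Katz1981CrystallineDieudonne]
* J. H. Silverman, *The Arithmetic of Elliptic Curves* (2009), IV.2.3, IV.4.4. [SilvermanAEC2009]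
-/

noncomputable section

open Ideal Filter Topology Field WittVector MvPowerSeries ValuativeRel

namespace Literature.NumberTheory.PAdicHodge

namespace AinfTop

open Literature.NumberTheory.GaloisRepresentations
open Literature.NumberTheory.GaloisRepresentations.IsNonarchimedeanLocalField
open Literature.NumberTheory.GaloisRepresentations.LubinTate
open Literature.NumberTheory.EllipticCurves

variable {F : Type} [Field F] [ValuativeRel F] [TopologicalSpace F] [IsNonarchimedeanLocalField F]
  {p : ℕ} [Fact p.Prime] [Fact (¬ IsUnit (p : integerC F))]
  [IsAdicComplete (Ideal.span {(p : integerC F)}) (integerC F)] [CharZero F]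
  {hθ : Function.Surjective (fontaineTheta (integerC F) p)}
  (W : WeierstrassCurve ℤ)

/-! ## §1 The Frobenius on `AinfTop`: continuity, evaluation, `θ ∘ φ` -/

omit [IsAdicComplete (Ideal.span {(p : integerC F)}) (integerC F)] [CharZero F] in
/-- **`φ(p, ξ) ⊆ (p, ξ)`**: `φ(p) = p` and `φ(ξ) = ξᵖ + p·h`. [cite: FontaineAsterisque223III, Exp. II §1.3] -/
theorem ideal_map_frob_le :
    (WithIdeal.i : Ideal (AinfTop F p)).map
        ((of F p).toRingHom.comp ((WittVector.frobenius : Ainf (p := p) F →+* Ainf (p := p) F).comp (of F p).symm.toRingHom)) ≤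
      WithIdeal.i := by
  rw [ideal_eq, Ideal.map_span, Ideal.span_le]
  rintro _ ⟨y, hy, rfl⟩
  simp only [Set.mem_insert_iff, Set.mem_singleton_iff] at hy
  rcases hy with rfl | rfl
  · rw [map_natCast]; exact Ideal.subset_span (by simp)
  · obtain ⟨h, hh⟩ := exists_frobenius_eq_pow_add (xi : Ainf (p := p) F)
    rw [SetLike.mem_coe, RingHom.comp_apply, RingHom.comp_apply, RingEquiv.toRingHom_eq_coe, RingEquiv.toRingHom_eq_coe, RingEquiv.coe_toRingHom,
      RingEquiv.coe_toRingHom, RingEquiv.symm_apply_apply, hh, map_add, map_pow, map_mul, map_natCast]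
    refine Ideal.add_mem _ (Ideal.pow_mem_of_mem _ (Ideal.subset_span (by simp)) _ (Fact.out : p.Prime).pos)
      (Ideal.mul_mem_right _ _ (Ideal.subset_span (by simp)))

omit [IsAdicComplete (Ideal.span {(p : integerC F)}) (integerC F)] [CharZero F] in
/-- **`φ` is continuous** on `AinfTop` (it preserves the defining ideal). [cite: FontaineAsterisque223III, Exp. II §1.3] -/
theorem continuous_frob :
    Continuous ((of F p).toRingHom.comp ((WittVector.frobenius : Ainf (p := p) F →+* Ainf (p := p) F).comp (of F p).symm.toRingHom)) :=
  (WithIdeal.uniformContinuous_of_map_le ideal_map_frob_le).continuous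

/-- **`φ` commutes with evaluation of integral power series**: `φ(f(x)) = f(φ x)` for `f ∈ ℤ⟦X_ι⟧` and a topologically nilpotent family `x`
(Mathlib `MvPowerSeries.comp_aeval`; `φ` is continuous and fixes `ℤ`). [cite: FontaineAsterisque223III, Exp. II §1.3] -/
theorem frob_aeval {ι : Type*} {x : ι → AinfTop F p} (hx : HasEval x) (f : MvPowerSeries ι ℤ) :
    ((of F p).toRingHom.comp ((WittVector.frobenius : Ainf (p := p) F →+* Ainf (p := p) F).comp (of F p).symm.toRingHom)) (aeval hx f) =
      aeval (hx.map (φ := (of F p).toRingHom.comp ((WittVector.frobenius : Ainf (p := p) F →+* Ainf (p := p) F).comp (of F p).symm.toRingHom))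
        continuous_frob) f := by
  have h := MvPowerSeries.comp_aeval hx
    (ε := ((of F p).toRingHom.comp ((WittVector.frobenius : Ainf (p := p) F →+* Ainf (p := p) F).comp (of F p).symm.toRingHom)).toIntAlgHom)
    continuous_frob
  exact AlgHom.congr_fun h f

omit [CharZero F] in
/-- **`θ(φ a) = θ(a)ᵖ + p·θ(h)`** for some `h` (`φ a = aᵖ + p·h` in `𝕎`, tree `exists_frobenius_eq_pow_add`). [cite: FontaineAsterisque223III, Exp. II §1.1] -/
theorem exists_theta_frob_eq (a : AinfTop F p) :
    ∃ h : AinfTop F p, theta F p (of F p ((WittVector.frobenius : Ainf (p := p) F →+* Ainf (p := p) F) ((of F p).symm a))) =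
      theta F p a ^ p + (p : CBall F) * theta F p h := by
  obtain ⟨h, hh⟩ := exists_frobenius_eq_pow_add ((of F p).symm a)
  refine ⟨of F p h, ?_⟩
  rw [hh, map_add, map_pow, map_mul, map_natCast, RingEquiv.apply_symm_apply, map_add, map_pow, map_mul, map_natCast]

omit [CharZero F] in
/-- **`‖θ(φ a) − θ(a)ᵖ‖ ≤ ‖p‖`** in `ℂ_F`. [cite: FontaineAsterisque223III, Exp. II §1.1] -/
theorem norm_theta_frob_sub_pow_le (a : AinfTop F p) :
    ‖((theta F p (of F p ((WittVector.frobenius : Ainf (p := p) F →+* Ainf (p := p) F) ((of F p).symm a))) : CBall F) : CompletedAlgClosure F) -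
        ((theta F p a : CBall F) : CompletedAlgClosure F) ^ p‖ ≤ ‖(p : CompletedAlgClosure F)‖ := by
  obtain ⟨h, hh⟩ := exists_theta_frob_eq a
  rw [hh]
  push_cast
  rw [add_sub_cancel_left, norm_mul]
  exact mul_le_of_le_one_right (norm_nonneg _) ((mem_unitBall_iff _).mp (theta F p h).2)

/-- **`φ𝔫 ⊆ 𝔫`**: if `‖θ(a)‖ < 1` then `‖θ(φ a)‖ ≤ max(‖θ(a)‖ᵖ, ‖p‖) < 1`. [cite: FontaineAsterisque223III, Exp. II §1.2.2] -/
theorem frob_mem_nilTheta {a : AinfTop F p} (ha : a ∈ (nilTheta F p hθ).toIdeal) :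
    of F p ((WittVector.frobenius : Ainf (p := p) F →+* Ainf (p := p) F) ((of F p).symm a)) ∈ (nilTheta F p hθ).toIdeal := by
  rw [mem_nilTheta_iff] at ha ⊢
  have h := norm_theta_frob_sub_pow_le a
  have hsplit : ((theta F p (of F p ((WittVector.frobenius : Ainf (p := p) F →+* Ainf (p := p) F) ((of F p).symm a))) : CBall F) :
      CompletedAlgClosure F) =
      (((theta F p (of F p ((WittVector.frobenius : Ainf (p := p) F →+* Ainf (p := p) F) ((of F p).symm a))) : CBall F) : CompletedAlgClosure F) -
        ((theta F p a : CBall F) : CompletedAlgClosure F) ^ p) + ((theta F p a : CBall F) : CompletedAlgClosure F) ^ p := by ring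
  rw [hsplit]
  refine (IsUltrametricDist.norm_add_le_max _ _).trans_lt (max_lt (h.trans_lt norm_natCast_C_lt_one') ?_)
  rw [norm_pow]
  exact pow_lt_one₀ (norm_nonneg _) ha (Fact.out : p.Prime).ne_zero

omit [IsAdicComplete (Ideal.span {(p : integerC F)}) (integerC F)] [CharZero F] in
/-- `φ` fixes the image of `ℤ`. [folklore] -/
private theorem frob_algebraMap_int (a : ℤ) :
    ((of F p).toRingHom.comp ((WittVector.frobenius : Ainf (p := p) F →+* Ainf (p := p) F).comp (of F p).symm.toRingHom))
        (algebraMap ℤ (AinfTop F p) a) = algebraMap ℤ (AinfTop F p) a := by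
  rw [algebraMap_int_eq, eq_intCast, map_intCast]

/-- **`φ(f(x)) = f(φ x)` as points of `𝔫`** for `f ∈ ℤ⟦X_ι⟧` without constant term. [cite: FontaineAsterisque223III, Exp. II §1.3] -/
theorem frob_evalPt {ι : Type*} [Finite ι] (f : MvPowerSeries ι ℤ) (hf : f.constantCoeff = 0)
    (x y : ι → (nilTheta F p hθ).toIdeal)
    (hxy : ∀ i, of F p ((WittVector.frobenius : Ainf (p := p) F →+* Ainf (p := p) F) ((of F p).symm (x i : AinfTop F p))) = y i) :
    of F p ((WittVector.frobenius : Ainf (p := p) F →+* Ainf (p := p) F) ((of F p).symm (evalPt (nilTheta F p hθ) f hf x : AinfTop F p))) =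
      (evalPt (nilTheta F p hθ) f hf y : AinfTop F p) := by
  have h := frob_aeval ((nilTheta F p hθ).hasEval x) f
  rw [coe_evalPt, coe_evalPt]
  rw [RingHom.comp_apply, RingHom.comp_apply] at h
  simp only [RingEquiv.toRingHom_eq_coe, RingEquiv.coe_toRingHom] at h
  rw [h]
  exact aeval_congr_point _ _ (funext fun i => by
    simp only [RingHom.comp_apply, RingEquiv.coe_toRingHom]
    exact hxy i) f

/-- ★ **`φ ∘ [p]_W = [p]_W ∘ φ` on `Ŵ(𝔫)`** (`[p]_W ∈ ℤ⟦X⟧`). [cite: SilvermanAEC2009, IV.2.3] [cite: FontaineAsterisque223III, Exp. II §1.3] -/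
theorem frob_mulP (a : (nilTheta F p hθ).toIdeal) :
    of F p ((WittVector.frobenius : Ainf (p := p) F →+* Ainf (p := p) F) ((of F p).symm (mulP W a : AinfTop F p))) =
      (mulP W ⟨of F p ((WittVector.frobenius : Ainf (p := p) F →+* Ainf (p := p) F) ((of F p).symm (a : AinfTop F p))),
        frob_mem_nilTheta a.2⟩ : AinfTop F p) :=
  frob_evalPt _ (W.constantCoeff_formalMul p) (fun _ : Unit => a) (fun _ : Unit => ⟨_, frob_mem_nilTheta a.2⟩) fun _ => rfl

/-! ## §2 The Frobenius-twisted tower `vₙ = θ(φ[ũ⁽ⁿ⁾])` -/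

/-- ★★ **The Frobenius-twisted tower.** For an exact `[p]_W`-division tower `u` of `Ŵ(𝔪_{ℂ_F})`, the sequence `vₙ := θ(φ[ũ⁽ⁿ⁾])` (`[ũ⁽ⁿ⁾]` the canonical
lift of the shifted tower `u(n + ·)`) is an EXACT `[p]_W`-division tower (`φ ∘ [p] = [p] ∘ φ`, `θ ∘ [p] = [p] ∘ θ`, `[p][ũ⁽ⁿ⁺¹⁾] = [ũ⁽ⁿ⁾]`), it is
`‖p‖`-close to `(uₙᵖ)ₙ` (`θ(φa) ≡ θ(a)ᵖ (mod p)`, `θ[ũ⁽ⁿ⁾] = uₙ`), and `v₀ = θ(φ[ũ])`.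
[cite: Colmez1992PeriodesAbeliennes, §2] [cite: Katz1981CrystallineDieudonne, Thm. 5.1.4] -/
theorem exists_frobTwist_divisionSeq {u : ℕ → (maxNilIdealC F).toIdeal} (hup : ∀ n, mulPC F p W (u (n + 1)) = u n) :
    ∃ v : ℕ → (maxNilIdealC F).toIdeal, (∀ n, mulPC F p W (v (n + 1)) = v n) ∧
      (∀ n, ‖(((v n : (maxNilIdealC F).toIdeal) : CBall F) : CompletedAlgClosure F) -
        (((u n : (maxNilIdealC F).toIdeal) : CBall F) : CompletedAlgClosure F) ^ p‖ ≤ ‖(p : CompletedAlgClosure F)‖) ∧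
      (((v 0 : (maxNilIdealC F).toIdeal) : CBall F) : CompletedAlgClosure F) =
        ((theta F p (of F p ((WittVector.frobenius : Ainf (p := p) F →+* Ainf (p := p) F) ((of F p).symm (torsionLift W hθ u hup)))) : CBall F) :
          CompletedAlgClosure F) := by
  -- the lifts `Tₙ = [ũ⁽ⁿ⁾] ∈ 𝔫` and their Frobenius images
  have hT : ∀ n, torsionLiftShift W hθ u hup n ∈ (nilTheta F p hθ).toIdeal := fun n => by
    rw [mem_nilTheta_iff, theta_torsionLiftShift]; exact (u n).2
  set φT : ℕ → AinfTop F p := fun n =>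
    of F p ((WittVector.frobenius : Ainf (p := p) F →+* Ainf (p := p) F) ((of F p).symm (torsionLiftShift W hθ u hup n))) with hφT
  have hφTmem : ∀ n, φT n ∈ (nilTheta F p hθ).toIdeal := fun n => frob_mem_nilTheta (hT n)
  refine ⟨fun n => ⟨theta F p (φT n), theta_mem_maxNilIdealC (hφTmem n)⟩, fun n => ?_, fun n => ?_, ?_⟩
  · -- exactness: `[p] θ(φ T_{n+1}) = θ([p] φ T_{n+1}) = θ(φ [p] T_{n+1}) = θ(φ Tₙ)`
    have h1 := theta_mulP W (hθ := hθ) ⟨φT (n + 1), hφTmem (n + 1)⟩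
    have h2 : (mulP W ⟨φT (n + 1), hφTmem (n + 1)⟩ : AinfTop F p) = φT n := by
      have h3 := frob_mulP W (hθ := hθ) (torsionLiftShiftPt W hθ u hup (n + 1))
      rw [mulP_torsionLiftShiftPt W hup n] at h3
      exact h3.symm
    apply Subtype.ext
    rw [← h1, h2]
  · -- closeness: `θ(φ Tₙ) ≡ θ(Tₙ)ᵖ = uₙᵖ (mod p)`
    have h := norm_theta_frob_sub_pow_le (torsionLiftShift W hθ u hup n)
    rw [theta_torsionLiftShift] at h
    exact h
  · rfl

/-- ★★ **`θ(φ[ũ]) = v₀` for ANY exact `[p]_W`-division tower `v` with `‖vₙ − uₙᵖ‖ ≤ ‖p‖`**: by the rigidity of `[p]`-towers (`mulPC_divisionSeq_unique`,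
`‖p‖ < 1`) such a `v` is the Frobenius-twisted tower of `exists_frobTwist_divisionSeq`. Hence `θ ∘ φ` of Fontaine's canonical lift is computed by
SATURATING the approximate tower `(uₙᵖ)ₙ`. [cite: Colmez1992PeriodesAbeliennes, §2] [cite: Katz1981CrystallineDieudonne, Thm. 5.1.4] -/
theorem theta_frob_torsionLift_eq {u : ℕ → (maxNilIdealC F).toIdeal} (hup : ∀ n, mulPC F p W (u (n + 1)) = u n)
    (v : ℕ → (maxNilIdealC F).toIdeal) (hv : ∀ n, mulPC F p W (v (n + 1)) = v n)
    (hvu : ∀ n, ‖(((v n : (maxNilIdealC F).toIdeal) : CBall F) : CompletedAlgClosure F) -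
      (((u n : (maxNilIdealC F).toIdeal) : CBall F) : CompletedAlgClosure F) ^ p‖ ≤ ‖(p : CompletedAlgClosure F)‖) :
    ((theta F p (of F p ((WittVector.frobenius : Ainf (p := p) F →+* Ainf (p := p) F) ((of F p).symm (torsionLift W hθ u hup)))) : CBall F) :
        CompletedAlgClosure F) =
      (((v 0 : (maxNilIdealC F).toIdeal) : CBall F) : CompletedAlgClosure F) := by
  obtain ⟨v', hv', hv'u, hv'0⟩ := exists_frobTwist_divisionSeq W (hθ := hθ) hup
  have heq : v = v' := by
    refine mulPC_divisionSeq_unique W (δ := ‖(p : CompletedAlgClosure F)‖) norm_natCast_C_lt_one' v v' hv hv' fun n => ?_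
    have hsplit : (((v n : (maxNilIdealC F).toIdeal) : CBall F) : CompletedAlgClosure F) -
        (((v' n : (maxNilIdealC F).toIdeal) : CBall F) : CompletedAlgClosure F) =
        ((((v n : (maxNilIdealC F).toIdeal) : CBall F) : CompletedAlgClosure F) -
          (((u n : (maxNilIdealC F).toIdeal) : CBall F) : CompletedAlgClosure F) ^ p) -
        ((((v' n : (maxNilIdealC F).toIdeal) : CBall F) : CompletedAlgClosure F) -
          (((u n : (maxNilIdealC F).toIdeal) : CBall F) : CompletedAlgClosure F) ^ p) := by ring
    rw [hsplit, sub_eq_add_neg]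
    refine (IsUltrametricDist.norm_add_le_max _ _).trans (max_le (hvu n) ?_)
    rw [norm_neg]; exact hv'u n
  rw [← hv'0, heq]

end AinfTop

end Literature.NumberTheory.PAdicHodge
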